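import Summits.Ventures.QEC.Census.BB.SD8Rows03
import Summits.Ventures.QEC.Census.BB.SD8Rows03
import Summits.Ventures.QEC.Census.BB.SD8Rows03
import Summits.Ventures.QEC.Census.BB.BBRows
import Summits.Ventures.QEC.Census.BB.Claims
import Literature.InformationTheory.QuantumCodes.TwoBlockConnectedComponents
import Literature.InformationTheory.QuantumCodes.TwoBlockToricLayout
import Literature.InformationTheory.QuantumCodes.TwoBlockWheelComponents
import Literature.InformationTheory.QuantumCodes.TwoBlockRootParameters
import HarnessLib
import HarnessLib.Audit.Tags

/-!
# Census rows as TYPED two-block codes `QC(A, B)` on `ℤ_ℓ × ℤ_m` — bridge batch `SD8RowsQC2` (3 row(s), kernel tier)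

Family: abelian two-block over ℤ_ℓ × ℤ_m (qec census one-module KERNEL-std rows: qec-search-7 certificate modules, MITM and
Brouwer–Zimmermann/automorphism formats). For each census row below (an EXPLICIT matrix code
`cert.code _ = CSSCode.ofMatrices (rowMatrix n cert.HX) (rowMatrix n cert.HZ)` with `IsCode n k d` certified in its own module), this file
puts the row's CONSTRUCTION into the kernel statement, as in the pilot `Census/BB/A1s_n144_k32_4addf704QC.lean` (p511732) and the
gen-4 batches `A1sRowsQC1–5` / `TwoBGARowsQC1–4`: monomial lists `la`, `lb` (from the certificate's construction record — the
docstring's `A_terms`/`B_terms` or the census row id `2bga-lℓmm-A…-B…`, monomials `xⁱyʲ` as `[i,j]`, convention of BCGMRY24 §4 =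
`BivariateBicycleCodes.lean`; the index identity was ALSO re-verified row-for-row by the emitter before filing), the typed object
`qc : BB.Code ℓ m := ⟨polyL la, polyL lb⟩`, the kernel INDEX IDENTITIES `cert.HX = BBRows.rowsX la lb`, `cert.HZ = BBRows.rowsZ la lb`
(`decide`; verified row generator `Census/BB/BBRows.lean`, p502918), the flat identities via `BBRows.rowMatrix_rowsX/Z`, the transport of
the row's own `dZ_eq` and `k` (its `k_eq`, or the `k`-component of its `isCode`) by type-05's `BB.Code.dZ_eq_of_flat` / `k_eq_of_flat` to
`qc_hasParams : BB.HasParams qc n k d` (census predicate of family BB, `Census/BB/Claims.lean`, distance EXACT) and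
`qc_isCode : qc.css.IsCode n k d`; and the census LAYOUT columns (Bravyi et al. 2024 §4 — arXiv:2308.07915: Lemma 2 p0010 L49, Lemma 3 p0011 L9, Lemma 4 p0011 L28; locators per qec-ref-2 2026-08-27T10:27Z) as KERNEL verdicts: «connected» —
`qc_tannerGraph_connected` (Lemma 3, `BB.Code.tannerGraph_connected_of_unit_mem`, explicit multiples of exponent differences) or
`qc_tannerGraph_not_connected` + `card_expDiffSubgroup` + `qc_card_connectedComponent` (`⟨S⟩` = an explicit finite carrier `diffList`,
both inclusions certified; exact component count by Lemma 3 (ii), `BB.Code.card_connectedComponent_mul_card`; by the tree's connected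
normal form `TwoBlockConnectedComponents.lean` such a code is the disjoint union of that many copies of its root code, whose parameters
`[[n/c, k/c, d]]` and connectedness are certified here as `root_isCode` via `TwoBlockRootParameters.lean`); «toric layout» —
`qc_hasToricLayoutWith μ λ` (Lemma 4, `BB.Code.hasToricLayoutWith_of_exponents`; omitted when its sufficient condition has no witness);
«wheel layers» — `qc_wheel_layers` (Lemma 2 minus planarity, `BB.Code.exists_wheel_layers`, weight-(3,3) rows only):

* `SD8lc_n90_k18_eb95b773` = `QC(1 + y + x + xy^11, 1 + y^14 + x^2 + x^2y^4)` on `ℤ_3 × ℤ_15`: `[[90, 18, 6]]`; Tanner graph connected; toric layout (15,3)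
* `SD8lc_n72_k12_e8d25dc5` = `QC(1 + y + y^4 + xy, 1 + y^8 + y^11 + x^2y^11)` on `ℤ_3 × ℤ_12`: `[[72, 12, 6]]`; Tanner graph connected; toric layout (12,3)
* `SD8lc_n50_k10_955a5347` = `QC(1 + y + x + xy^2, 1 + y^4 + x^4 + x^4y^3)` on `ℤ_5 × ℤ_5`: `[[50, 10, 5]]`; Tanner graph connected; toric layout (5,5)

No new certificate — tier KERNEL, axioms standard, no `native_decide`. HONEST FRAMING: identifies already-certified census objects with
named algebraic constructions and decides structural (graph) properties; the census comparator columns (printed values, optimality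
words) are not touched; for disconnected rows the root code is identified abstractly over `↥⟨S⟩` (not re-indexed to a named `QC(A',B')`,
not identified with a smaller census row); planarity/thickness is not asserted. Generated by
qec-type-05 gen 5's `tools/emit_qc_bridge2.py` + `tools/conn_cert.py` (HOME/lean/type-05/tools/).
-/

namespace Summit.Ventures.QEC.Census.SD8lc_n90_k18_eb95b773

open Matrix Literature.InformationTheory.QuantumCodes BBRows

/-- Monomials of `A = 1 + y + x + xy^11` (construction `A_terms = [[0, 0], [0, 1], [1, 0], [1, 11]]`, from the census generator file `census/search-3/gens/sd8/SD8lc_n90_k18_eb95b773.json` (matrix_sha256 `eb95b7734a162369…`; `A = 1+y+x+x*y^11`, `B = 1+y^14+x^2+x^2*y^4`)). DATA. -/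
def la : List (BB.Mono 3 15) := [(Fin.ofNat 3 0, Fin.ofNat 15 0), (Fin.ofNat 3 0, Fin.ofNat 15 1), (Fin.ofNat 3 1, Fin.ofNat 15 0), (Fin.ofNat 3 1, Fin.ofNat 15 11)]

/-- Monomials of `B = 1 + y^14 + x^2 + x^2y^4` (construction `B_terms = [[0, 0], [0, 14], [2, 0], [2, 4]]`). DATA. -/
def lb : List (BB.Mono 3 15) := [(Fin.ofNat 3 0, Fin.ofNat 15 0), (Fin.ofNat 3 0, Fin.ofNat 15 14), (Fin.ofNat 3 2, Fin.ofNat 15 0), (Fin.ofNat 3 2, Fin.ofNat 15 4)]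

/-- The census row's code as a TYPED two-block code `QC(1 + y + x + xy^11, 1 + y^14 + x^2 + x^2y^4)` on `ℤ_3 × ℤ_15` (`BB.Code 3 15`). (definition) -/
def qc : BB.Code 3 15 := ⟨polyL la, polyL lb⟩

set_option maxRecDepth 100000 in
/-- INDEX IDENTITY, `X` side, in the kernel: the certificate's `H^X` rows ARE the `X`-check words of `qc` (`decide +kernel`). -/
theorem HX_eq_rowsX : SD8lc_n90_k18_eb95b773.cert.HX = rowsX la lb := by
  decide +kernel

set_option maxRecDepth 100000 in
/-- INDEX IDENTITY, `Z` side. -/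
theorem HZ_eq_rowsZ : SD8lc_n90_k18_eb95b773.cert.HZ = rowsZ la lb := by
  decide +kernel

set_option maxRecDepth 100000 in
/-- The certificate's flat `H^X` is `qc.HXFlat`. -/
theorem rowMatrix_HX_eq : rowMatrix 90 SD8lc_n90_k18_eb95b773.cert.HX = qc.HXFlat := by
  have cast : ∀ {H H' : List ℕ} (e : H = H'),
      rowMatrix 90 H = (rowMatrix 90 H').submatrix (Fin.cast (congrArg List.length e)) id := by
    intro H H' e; subst e; rfl
  exact (cast HX_eq_rowsX).trans (rowMatrix_rowsX qc (LA := la) (LB := lb) rfl rfl)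

set_option maxRecDepth 100000 in
/-- The certificate's flat `H^Z` is `qc.HZFlat`. -/
theorem rowMatrix_HZ_eq : rowMatrix 90 SD8lc_n90_k18_eb95b773.cert.HZ = qc.HZFlat := by
  have cast : ∀ {H H' : List ℕ} (e : H = H'),
      rowMatrix 90 H = (rowMatrix 90 H').submatrix (Fin.cast (congrArg List.length e)) id := by
    intro H H' e; subst e; rfl
  exact (cast HZ_eq_rowsZ).trans (rowMatrix_rowsZ qc (LA := la) (LB := lb) rfl rfl)

set_option maxRecDepth 100000 in
/-- `d^Z (qc) = 6`, transported from the census certificate (`SD8lc_n90_k18_eb95b773.dZ_eq`) by `BB.Code.dZ_eq_of_flat`. -/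
theorem qc_dZ : qc.css.dZ = 6 :=
  (qc.dZ_eq_of_flat (D := SD8lc_n90_k18_eb95b773.cert.code SD8lc_n90_k18_eb95b773.commOK_cert)
    rowMatrix_HX_eq rowMatrix_HZ_eq).symm.trans SD8lc_n90_k18_eb95b773.dZ_eq

set_option maxRecDepth 100000 in
/-- `k (qc) = 18`, transported from the census certificate (`SD8lc_n90_k18_eb95b773.k_eq`) by `BB.Code.k_eq_of_flat`. -/
theorem qc_k : qc.k = 18 :=
  (qc.k_eq_of_flat (D := SD8lc_n90_k18_eb95b773.cert.code SD8lc_n90_k18_eb95b773.commOK_cert)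
    rowMatrix_HX_eq rowMatrix_HZ_eq).symm.trans SD8lc_n90_k18_eb95b773.k_eq

/-- **`QC(1 + y + x + xy^11, 1 + y^14 + x^2 + x^2y^4)` on `ℤ_3 × ℤ_15` has parameters `[[90, 18, 6]]`** (distance exact; `BB.HasParams`) — the census row
`SD8lc_n90_k18_eb95b773` read as a statement about the construction. KERNEL. -/
theorem qc_hasParams : Summit.Ventures.QEC.BB.HasParams qc 90 18 6 :=
  BB.hasParams_of_dZ (by simp only [BB.numQubits_eq]) qc_k qc_dZ

/-- The same in the generic census vocabulary: `qc.css.IsCode 90 18 6`. -/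
theorem qc_isCode : qc.css.IsCode 90 18 6 :=
  (BB.hasParams_iff_isCode (by decide)).1 qc_hasParams

set_option maxRecDepth 100000 in
/-- **The Tanner graph of `qc` is connected** (Bravyi et al. 2024 Lemma 3 / `BB.Code.tannerGraph_connected_of_unit_mem`): `x = (1,0)`
and `y = (0,1)` are explicit combinations of exponent differences inside `A` or inside `B` (found by qec-type-05's tools/conn_cert.py,
re-checked by `decide`). Census column «connected» for this row, KERNEL. -/
theorem qc_tannerGraph_connected : qc.css.tannerGraph.Connected := by
  refine qc.tannerGraph_connected_of_unit_mem (fun h => absurd (congrFun h ((0 : Fin 3), (0 : Fin 15))) (by decide))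
    (fun h => absurd (congrFun h ((0 : Fin 3), (0 : Fin 15))) (by decide)) ?_ ?_
  · have e : (((1 : Fin 3), (0 : Fin 15)) : BB.Mono 3 15) = (2 : ℕ) • ((((0 : Fin 3), (0 : Fin 15))) - (1, 0)) := by decide
    rw [e]
    exact (AddSubgroup.nsmul_mem _ (qc.sub_mem_expDiffSubgroup_A (by decide) (by decide)) 2)
  · have e : (((0 : Fin 3), (1 : Fin 15)) : BB.Mono 3 15) = (14 : ℕ) • ((((0 : Fin 3), (0 : Fin 15))) - (0, 1)) := by decide
    rw [e]
    exact (AddSubgroup.nsmul_mem _ (qc.sub_mem_expDiffSubgroup_A (by decide) (by decide)) 14)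

/-- The two layout generators `A_iA_jᵀ ↦ (0, 0) − (0, 1)` and `B_gB_hᵀ ↦ (0, 0) − (2, 0)` generate `ℤ_3 × ℤ_15`
(explicit multiples giving `x` and `y`, `decide`d). -/
theorem qc_layout_closure_eq_top : AddSubgroup.closure ({((0 : Fin 3), (0 : Fin 15)) - (0, 1), ((0 : Fin 3), (0 : Fin 15)) - (2, 0)} : Set (BB.Mono 3 15)) = ⊤ := by
  apply BB.Code.addSubgroup_eq_top_of_unit_mem
  · have h1 := AddSubgroup.subset_closure (k := ({((0 : Fin 3), (0 : Fin 15)) - (0, 1), ((0 : Fin 3), (0 : Fin 15)) - (2, 0)} : Set (BB.Mono 3 15))) (Set.mem_insert _ _)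
    have h2 := AddSubgroup.subset_closure (k := ({((0 : Fin 3), (0 : Fin 15)) - (0, 1), ((0 : Fin 3), (0 : Fin 15)) - (2, 0)} : Set (BB.Mono 3 15))) (Set.mem_insert_of_mem _ rfl)
    have e : (0 : ℕ) • (((0 : Fin 3), (0 : Fin 15)) - (0, 1)) + (1 : ℕ) • (((0 : Fin 3), (0 : Fin 15)) - (2, 0)) = (1, 0) := by decide
    have h' := AddSubgroup.add_mem _ (AddSubgroup.nsmul_mem _ h1 0) (AddSubgroup.nsmul_mem _ h2 1)
    rw [e] at h'
    exact h'
  · have h1 := AddSubgroup.subset_closure (k := ({((0 : Fin 3), (0 : Fin 15)) - (0, 1), ((0 : Fin 3), (0 : Fin 15)) - (2, 0)} : Set (BB.Mono 3 15))) (Set.mem_insert _ _)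
    have h2 := AddSubgroup.subset_closure (k := ({((0 : Fin 3), (0 : Fin 15)) - (0, 1), ((0 : Fin 3), (0 : Fin 15)) - (2, 0)} : Set (BB.Mono 3 15))) (Set.mem_insert_of_mem _ rfl)
    have e : (14 : ℕ) • (((0 : Fin 3), (0 : Fin 15)) - (0, 1)) + (0 : ℕ) • (((0 : Fin 3), (0 : Fin 15)) - (2, 0)) = (0, 1) := by decide
    have h' := AddSubgroup.add_mem _ (AddSubgroup.nsmul_mem _ h1 14) (AddSubgroup.nsmul_mem _ h2 0)
    rw [e] at h'
    exact h'

set_option maxRecDepth 100000 in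
/-- Orders of the two layout generators: `15` and `3` (product `45 = ℓm`). -/
theorem qc_layout_orders : addOrderOf (((0 : Fin 3), (0 : Fin 15)) - (0, 1)) = 15 ∧ addOrderOf (((0 : Fin 3), (0 : Fin 15)) - (2, 0)) = 3 :=
  ⟨(addOrderOf_eq_iff (by norm_num)).mpr (by decide), (addOrderOf_eq_iff (by norm_num)).mpr (by decide)⟩

/-- **`qc` has a toric layout with `(μ, λ) = (15, 3)`** (Bravyi et al. 2024 Lemma 4 / `BB.Code.hasToricLayoutWith_of_exponents`):
census layout column, KERNEL. -/
theorem qc_hasToricLayoutWith : HasToricLayoutWith 15 3 qc.css.tannerGraph := by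
  have h := qc.hasToricLayoutWith_of_exponents (g := ((0 : Fin 3), (0 : Fin 15))) (g' := (0, 1))
    (h := ((0 : Fin 3), (0 : Fin 15))) (h' := (2, 0)) (by decide) (by decide) (by decide) (by decide)
    qc_layout_closure_eq_top (by rw [qc_layout_orders.1, qc_layout_orders.2])
  rwa [qc_layout_orders.1, qc_layout_orders.2] at h

/-- `qc` has a toric layout. KERNEL. -/
theorem qc_hasToricLayout : HasToricLayout qc.css.tannerGraph :=
  ⟨15, 3, by norm_num, by norm_num, qc_hasToricLayoutWith⟩

end Summit.Ventures.QEC.Census.SD8lc_n90_k18_eb95b773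

namespace Summit.Ventures.QEC.Census.SD8lc_n72_k12_e8d25dc5

open Matrix Literature.InformationTheory.QuantumCodes BBRows

/-- Monomials of `A = 1 + y + y^4 + xy` (construction `A_terms = [[0, 0], [0, 1], [0, 4], [1, 1]]`, from the census generator file `census/search-3/gens/sd8/SD8lc_n72_k12_e8d25dc5.json` (matrix_sha256 `e8d25dc5c3f06f8c…`; `A = 1+y+y^4+x*y`, `B = 1+y^8+y^11+x^2*y^11`)). DATA. -/
def la : List (BB.Mono 3 12) := [(Fin.ofNat 3 0, Fin.ofNat 12 0), (Fin.ofNat 3 0, Fin.ofNat 12 1), (Fin.ofNat 3 0, Fin.ofNat 12 4), (Fin.ofNat 3 1, Fin.ofNat 12 1)]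

/-- Monomials of `B = 1 + y^8 + y^11 + x^2y^11` (construction `B_terms = [[0, 0], [0, 8], [0, 11], [2, 11]]`). DATA. -/
def lb : List (BB.Mono 3 12) := [(Fin.ofNat 3 0, Fin.ofNat 12 0), (Fin.ofNat 3 0, Fin.ofNat 12 8), (Fin.ofNat 3 0, Fin.ofNat 12 11), (Fin.ofNat 3 2, Fin.ofNat 12 11)]

/-- The census row's code as a TYPED two-block code `QC(1 + y + y^4 + xy, 1 + y^8 + y^11 + x^2y^11)` on `ℤ_3 × ℤ_12` (`BB.Code 3 12`). (definition) -/
def qc : BB.Code 3 12 := ⟨polyL la, polyL lb⟩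

set_option maxRecDepth 100000 in
/-- INDEX IDENTITY, `X` side, in the kernel: the certificate's `H^X` rows ARE the `X`-check words of `qc` (`decide +kernel`). -/
theorem HX_eq_rowsX : SD8lc_n72_k12_e8d25dc5.cert.HX = rowsX la lb := by
  decide +kernel

set_option maxRecDepth 100000 in
/-- INDEX IDENTITY, `Z` side. -/
theorem HZ_eq_rowsZ : SD8lc_n72_k12_e8d25dc5.cert.HZ = rowsZ la lb := by
  decide +kernel

set_option maxRecDepth 100000 in
/-- The certificate's flat `H^X` is `qc.HXFlat`. -/
theorem rowMatrix_HX_eq : rowMatrix 72 SD8lc_n72_k12_e8d25dc5.cert.HX = qc.HXFlat := by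
  have cast : ∀ {H H' : List ℕ} (e : H = H'),
      rowMatrix 72 H = (rowMatrix 72 H').submatrix (Fin.cast (congrArg List.length e)) id := by
    intro H H' e; subst e; rfl
  exact (cast HX_eq_rowsX).trans (rowMatrix_rowsX qc (LA := la) (LB := lb) rfl rfl)

set_option maxRecDepth 100000 in
/-- The certificate's flat `H^Z` is `qc.HZFlat`. -/
theorem rowMatrix_HZ_eq : rowMatrix 72 SD8lc_n72_k12_e8d25dc5.cert.HZ = qc.HZFlat := by
  have cast : ∀ {H H' : List ℕ} (e : H = H'),
      rowMatrix 72 H = (rowMatrix 72 H').submatrix (Fin.cast (congrArg List.length e)) id := by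
    intro H H' e; subst e; rfl
  exact (cast HZ_eq_rowsZ).trans (rowMatrix_rowsZ qc (LA := la) (LB := lb) rfl rfl)

set_option maxRecDepth 100000 in
/-- `d^Z (qc) = 6`, transported from the census certificate (`SD8lc_n72_k12_e8d25dc5.dZ_eq`) by `BB.Code.dZ_eq_of_flat`. -/
theorem qc_dZ : qc.css.dZ = 6 :=
  (qc.dZ_eq_of_flat (D := SD8lc_n72_k12_e8d25dc5.cert.code SD8lc_n72_k12_e8d25dc5.commOK_cert)
    rowMatrix_HX_eq rowMatrix_HZ_eq).symm.trans SD8lc_n72_k12_e8d25dc5.dZ_eq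

set_option maxRecDepth 100000 in
/-- `k (qc) = 12`, transported from the census certificate (`SD8lc_n72_k12_e8d25dc5.k_eq`) by `BB.Code.k_eq_of_flat`. -/
theorem qc_k : qc.k = 12 :=
  (qc.k_eq_of_flat (D := SD8lc_n72_k12_e8d25dc5.cert.code SD8lc_n72_k12_e8d25dc5.commOK_cert)
    rowMatrix_HX_eq rowMatrix_HZ_eq).symm.trans SD8lc_n72_k12_e8d25dc5.k_eq

/-- **`QC(1 + y + y^4 + xy, 1 + y^8 + y^11 + x^2y^11)` on `ℤ_3 × ℤ_12` has parameters `[[72, 12, 6]]`** (distance exact; `BB.HasParams`) — the census row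
`SD8lc_n72_k12_e8d25dc5` read as a statement about the construction. KERNEL. -/
theorem qc_hasParams : Summit.Ventures.QEC.BB.HasParams qc 72 12 6 :=
  BB.hasParams_of_dZ (by simp only [BB.numQubits_eq]) qc_k qc_dZ

/-- The same in the generic census vocabulary: `qc.css.IsCode 72 12 6`. -/
theorem qc_isCode : qc.css.IsCode 72 12 6 :=
  (BB.hasParams_iff_isCode (by decide)).1 qc_hasParams

set_option maxRecDepth 100000 in
/-- **The Tanner graph of `qc` is connected** (Bravyi et al. 2024 Lemma 3 / `BB.Code.tannerGraph_connected_of_unit_mem`): `x = (1,0)`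
and `y = (0,1)` are explicit combinations of exponent differences inside `A` or inside `B` (found by qec-type-05's tools/conn_cert.py,
re-checked by `decide`). Census column «connected» for this row, KERNEL. -/
theorem qc_tannerGraph_connected : qc.css.tannerGraph.Connected := by
  refine qc.tannerGraph_connected_of_unit_mem (fun h => absurd (congrFun h ((0 : Fin 3), (0 : Fin 12))) (by decide))
    (fun h => absurd (congrFun h ((0 : Fin 3), (0 : Fin 12))) (by decide)) ?_ ?_
  · have e : (((1 : Fin 3), (0 : Fin 12)) : BB.Mono 3 12) = (2 : ℕ) • ((((0 : Fin 3), (1 : Fin 12))) - (1, 1)) := by decide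
    rw [e]
    exact (AddSubgroup.nsmul_mem _ (qc.sub_mem_expDiffSubgroup_A (by decide) (by decide)) 2)
  · have e : (((0 : Fin 3), (1 : Fin 12)) : BB.Mono 3 12) = (11 : ℕ) • ((((0 : Fin 3), (0 : Fin 12))) - (0, 1)) := by decide
    rw [e]
    exact (AddSubgroup.nsmul_mem _ (qc.sub_mem_expDiffSubgroup_A (by decide) (by decide)) 11)

/-- The two layout generators `A_iA_jᵀ ↦ (0, 0) − (0, 1)` and `B_gB_hᵀ ↦ (0, 11) − (2, 11)` generate `ℤ_3 × ℤ_12`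
(explicit multiples giving `x` and `y`, `decide`d). -/
theorem qc_layout_closure_eq_top : AddSubgroup.closure ({((0 : Fin 3), (0 : Fin 12)) - (0, 1), ((0 : Fin 3), (11 : Fin 12)) - (2, 11)} : Set (BB.Mono 3 12)) = ⊤ := by
  apply BB.Code.addSubgroup_eq_top_of_unit_mem
  · have h1 := AddSubgroup.subset_closure (k := ({((0 : Fin 3), (0 : Fin 12)) - (0, 1), ((0 : Fin 3), (11 : Fin 12)) - (2, 11)} : Set (BB.Mono 3 12))) (Set.mem_insert _ _)
    have h2 := AddSubgroup.subset_closure (k := ({((0 : Fin 3), (0 : Fin 12)) - (0, 1), ((0 : Fin 3), (11 : Fin 12)) - (2, 11)} : Set (BB.Mono 3 12))) (Set.mem_insert_of_mem _ rfl)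
    have e : (0 : ℕ) • (((0 : Fin 3), (0 : Fin 12)) - (0, 1)) + (1 : ℕ) • (((0 : Fin 3), (11 : Fin 12)) - (2, 11)) = (1, 0) := by decide
    have h' := AddSubgroup.add_mem _ (AddSubgroup.nsmul_mem _ h1 0) (AddSubgroup.nsmul_mem _ h2 1)
    rw [e] at h'
    exact h'
  · have h1 := AddSubgroup.subset_closure (k := ({((0 : Fin 3), (0 : Fin 12)) - (0, 1), ((0 : Fin 3), (11 : Fin 12)) - (2, 11)} : Set (BB.Mono 3 12))) (Set.mem_insert _ _)
    have h2 := AddSubgroup.subset_closure (k := ({((0 : Fin 3), (0 : Fin 12)) - (0, 1), ((0 : Fin 3), (11 : Fin 12)) - (2, 11)} : Set (BB.Mono 3 12))) (Set.mem_insert_of_mem _ rfl)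
    have e : (11 : ℕ) • (((0 : Fin 3), (0 : Fin 12)) - (0, 1)) + (0 : ℕ) • (((0 : Fin 3), (11 : Fin 12)) - (2, 11)) = (0, 1) := by decide
    have h' := AddSubgroup.add_mem _ (AddSubgroup.nsmul_mem _ h1 11) (AddSubgroup.nsmul_mem _ h2 0)
    rw [e] at h'
    exact h'

set_option maxRecDepth 100000 in
/-- Orders of the two layout generators: `12` and `3` (product `36 = ℓm`). -/
theorem qc_layout_orders : addOrderOf (((0 : Fin 3), (0 : Fin 12)) - (0, 1)) = 12 ∧ addOrderOf (((0 : Fin 3), (11 : Fin 12)) - (2, 11)) = 3 :=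
  ⟨(addOrderOf_eq_iff (by norm_num)).mpr (by decide), (addOrderOf_eq_iff (by norm_num)).mpr (by decide)⟩

/-- **`qc` has a toric layout with `(μ, λ) = (12, 3)`** (Bravyi et al. 2024 Lemma 4 / `BB.Code.hasToricLayoutWith_of_exponents`):
census layout column, KERNEL. -/
theorem qc_hasToricLayoutWith : HasToricLayoutWith 12 3 qc.css.tannerGraph := by
  have h := qc.hasToricLayoutWith_of_exponents (g := ((0 : Fin 3), (0 : Fin 12))) (g' := (0, 1))
    (h := ((0 : Fin 3), (11 : Fin 12))) (h' := (2, 11)) (by decide) (by decide) (by decide) (by decide)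
    qc_layout_closure_eq_top (by rw [qc_layout_orders.1, qc_layout_orders.2])
  rwa [qc_layout_orders.1, qc_layout_orders.2] at h

/-- `qc` has a toric layout. KERNEL. -/
theorem qc_hasToricLayout : HasToricLayout qc.css.tannerGraph :=
  ⟨12, 3, by norm_num, by norm_num, qc_hasToricLayoutWith⟩

end Summit.Ventures.QEC.Census.SD8lc_n72_k12_e8d25dc5

namespace Summit.Ventures.QEC.Census.SD8lc_n50_k10_955a5347

open Matrix Literature.InformationTheory.QuantumCodes BBRows

/-- Monomials of `A = 1 + y + x + xy^2` (construction `A_terms = [[0, 0], [0, 1], [1, 0], [1, 2]]`, from the census generator file `census/search-3/gens/sd8/SD8lc_n50_k10_955a5347.json` (matrix_sha256 `955a5347e467f3d3…`; `A = 1+y+x+x*y^2`, `B = 1+y^4+x^4+x^4*y^3`)). DATA. -/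
def la : List (BB.Mono 5 5) := [(Fin.ofNat 5 0, Fin.ofNat 5 0), (Fin.ofNat 5 0, Fin.ofNat 5 1), (Fin.ofNat 5 1, Fin.ofNat 5 0), (Fin.ofNat 5 1, Fin.ofNat 5 2)]

/-- Monomials of `B = 1 + y^4 + x^4 + x^4y^3` (construction `B_terms = [[0, 0], [0, 4], [4, 0], [4, 3]]`). DATA. -/
def lb : List (BB.Mono 5 5) := [(Fin.ofNat 5 0, Fin.ofNat 5 0), (Fin.ofNat 5 0, Fin.ofNat 5 4), (Fin.ofNat 5 4, Fin.ofNat 5 0), (Fin.ofNat 5 4, Fin.ofNat 5 3)]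

/-- The census row's code as a TYPED two-block code `QC(1 + y + x + xy^2, 1 + y^4 + x^4 + x^4y^3)` on `ℤ_5 × ℤ_5` (`BB.Code 5 5`). (definition) -/
def qc : BB.Code 5 5 := ⟨polyL la, polyL lb⟩

set_option maxRecDepth 100000 in
/-- INDEX IDENTITY, `X` side, in the kernel: the certificate's `H^X` rows ARE the `X`-check words of `qc` (`decide +kernel`). -/
theorem HX_eq_rowsX : SD8lc_n50_k10_955a5347.cert.HX = rowsX la lb := by
  decide +kernel

set_option maxRecDepth 100000 in
/-- INDEX IDENTITY, `Z` side. -/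
theorem HZ_eq_rowsZ : SD8lc_n50_k10_955a5347.cert.HZ = rowsZ la lb := by
  decide +kernel

set_option maxRecDepth 100000 in
/-- The certificate's flat `H^X` is `qc.HXFlat`. -/
theorem rowMatrix_HX_eq : rowMatrix 50 SD8lc_n50_k10_955a5347.cert.HX = qc.HXFlat := by
  have cast : ∀ {H H' : List ℕ} (e : H = H'),
      rowMatrix 50 H = (rowMatrix 50 H').submatrix (Fin.cast (congrArg List.length e)) id := by
    intro H H' e; subst e; rfl
  exact (cast HX_eq_rowsX).trans (rowMatrix_rowsX qc (LA := la) (LB := lb) rfl rfl)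

set_option maxRecDepth 100000 in
/-- The certificate's flat `H^Z` is `qc.HZFlat`. -/
theorem rowMatrix_HZ_eq : rowMatrix 50 SD8lc_n50_k10_955a5347.cert.HZ = qc.HZFlat := by
  have cast : ∀ {H H' : List ℕ} (e : H = H'),
      rowMatrix 50 H = (rowMatrix 50 H').submatrix (Fin.cast (congrArg List.length e)) id := by
    intro H H' e; subst e; rfl
  exact (cast HZ_eq_rowsZ).trans (rowMatrix_rowsZ qc (LA := la) (LB := lb) rfl rfl)

set_option maxRecDepth 100000 in
/-- `d^Z (qc) = 5`, transported from the census certificate (`SD8lc_n50_k10_955a5347.dZ_eq`) by `BB.Code.dZ_eq_of_flat`. -/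
theorem qc_dZ : qc.css.dZ = 5 :=
  (qc.dZ_eq_of_flat (D := SD8lc_n50_k10_955a5347.cert.code SD8lc_n50_k10_955a5347.commOK_cert)
    rowMatrix_HX_eq rowMatrix_HZ_eq).symm.trans SD8lc_n50_k10_955a5347.dZ_eq

set_option maxRecDepth 100000 in
/-- `k (qc) = 10`, transported from the census certificate (`SD8lc_n50_k10_955a5347.k_eq`) by `BB.Code.k_eq_of_flat`. -/
theorem qc_k : qc.k = 10 :=
  (qc.k_eq_of_flat (D := SD8lc_n50_k10_955a5347.cert.code SD8lc_n50_k10_955a5347.commOK_cert)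
    rowMatrix_HX_eq rowMatrix_HZ_eq).symm.trans SD8lc_n50_k10_955a5347.k_eq

/-- **`QC(1 + y + x + xy^2, 1 + y^4 + x^4 + x^4y^3)` on `ℤ_5 × ℤ_5` has parameters `[[50, 10, 5]]`** (distance exact; `BB.HasParams`) — the census row
`SD8lc_n50_k10_955a5347` read as a statement about the construction. KERNEL. -/
theorem qc_hasParams : Summit.Ventures.QEC.BB.HasParams qc 50 10 5 :=
  BB.hasParams_of_dZ (by simp only [BB.numQubits_eq]) qc_k qc_dZ

/-- The same in the generic census vocabulary: `qc.css.IsCode 50 10 5`. -/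
theorem qc_isCode : qc.css.IsCode 50 10 5 :=
  (BB.hasParams_iff_isCode (by decide)).1 qc_hasParams

set_option maxRecDepth 100000 in
/-- **The Tanner graph of `qc` is connected** (Bravyi et al. 2024 Lemma 3 / `BB.Code.tannerGraph_connected_of_unit_mem`): `x = (1,0)`
and `y = (0,1)` are explicit combinations of exponent differences inside `A` or inside `B` (found by qec-type-05's tools/conn_cert.py,
re-checked by `decide`). Census column «connected» for this row, KERNEL. -/
theorem qc_tannerGraph_connected : qc.css.tannerGraph.Connected := by
  refine qc.tannerGraph_connected_of_unit_mem (fun h => absurd (congrFun h ((0 : Fin 5), (0 : Fin 5))) (by decide))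
    (fun h => absurd (congrFun h ((0 : Fin 5), (0 : Fin 5))) (by decide)) ?_ ?_
  · have e : (((1 : Fin 5), (0 : Fin 5)) : BB.Mono 5 5) = (4 : ℕ) • ((((0 : Fin 5), (0 : Fin 5))) - (1, 0)) := by decide
    rw [e]
    exact (AddSubgroup.nsmul_mem _ (qc.sub_mem_expDiffSubgroup_A (by decide) (by decide)) 4)
  · have e : (((0 : Fin 5), (1 : Fin 5)) : BB.Mono 5 5) = (4 : ℕ) • ((((0 : Fin 5), (0 : Fin 5))) - (0, 1)) := by decide
    rw [e]
    exact (AddSubgroup.nsmul_mem _ (qc.sub_mem_expDiffSubgroup_A (by decide) (by decide)) 4)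

/-- The two layout generators `A_iA_jᵀ ↦ (0, 0) − (0, 1)` and `B_gB_hᵀ ↦ (0, 0) − (4, 0)` generate `ℤ_5 × ℤ_5`
(explicit multiples giving `x` and `y`, `decide`d). -/
theorem qc_layout_closure_eq_top : AddSubgroup.closure ({((0 : Fin 5), (0 : Fin 5)) - (0, 1), ((0 : Fin 5), (0 : Fin 5)) - (4, 0)} : Set (BB.Mono 5 5)) = ⊤ := by
  apply BB.Code.addSubgroup_eq_top_of_unit_mem
  · have h1 := AddSubgroup.subset_closure (k := ({((0 : Fin 5), (0 : Fin 5)) - (0, 1), ((0 : Fin 5), (0 : Fin 5)) - (4, 0)} : Set (BB.Mono 5 5))) (Set.mem_insert _ _)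
    have h2 := AddSubgroup.subset_closure (k := ({((0 : Fin 5), (0 : Fin 5)) - (0, 1), ((0 : Fin 5), (0 : Fin 5)) - (4, 0)} : Set (BB.Mono 5 5))) (Set.mem_insert_of_mem _ rfl)
    have e : (0 : ℕ) • (((0 : Fin 5), (0 : Fin 5)) - (0, 1)) + (1 : ℕ) • (((0 : Fin 5), (0 : Fin 5)) - (4, 0)) = (1, 0) := by decide
    have h' := AddSubgroup.add_mem _ (AddSubgroup.nsmul_mem _ h1 0) (AddSubgroup.nsmul_mem _ h2 1)
    rw [e] at h'
    exact h'
  · have h1 := AddSubgroup.subset_closure (k := ({((0 : Fin 5), (0 : Fin 5)) - (0, 1), ((0 : Fin 5), (0 : Fin 5)) - (4, 0)} : Set (BB.Mono 5 5))) (Set.mem_insert _ _)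
    have h2 := AddSubgroup.subset_closure (k := ({((0 : Fin 5), (0 : Fin 5)) - (0, 1), ((0 : Fin 5), (0 : Fin 5)) - (4, 0)} : Set (BB.Mono 5 5))) (Set.mem_insert_of_mem _ rfl)
    have e : (4 : ℕ) • (((0 : Fin 5), (0 : Fin 5)) - (0, 1)) + (0 : ℕ) • (((0 : Fin 5), (0 : Fin 5)) - (4, 0)) = (0, 1) := by decide
    have h' := AddSubgroup.add_mem _ (AddSubgroup.nsmul_mem _ h1 4) (AddSubgroup.nsmul_mem _ h2 0)
    rw [e] at h'
    exact h'

set_option maxRecDepth 100000 in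
/-- Orders of the two layout generators: `5` and `5` (product `25 = ℓm`). -/
theorem qc_layout_orders : addOrderOf (((0 : Fin 5), (0 : Fin 5)) - (0, 1)) = 5 ∧ addOrderOf (((0 : Fin 5), (0 : Fin 5)) - (4, 0)) = 5 :=
  ⟨(addOrderOf_eq_iff (by norm_num)).mpr (by decide), (addOrderOf_eq_iff (by norm_num)).mpr (by decide)⟩

/-- **`qc` has a toric layout with `(μ, λ) = (5, 5)`** (Bravyi et al. 2024 Lemma 4 / `BB.Code.hasToricLayoutWith_of_exponents`):
census layout column, KERNEL. -/
theorem qc_hasToricLayoutWith : HasToricLayoutWith 5 5 qc.css.tannerGraph := by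
  have h := qc.hasToricLayoutWith_of_exponents (g := ((0 : Fin 5), (0 : Fin 5))) (g' := (0, 1))
    (h := ((0 : Fin 5), (0 : Fin 5))) (h' := (4, 0)) (by decide) (by decide) (by decide) (by decide)
    qc_layout_closure_eq_top (by rw [qc_layout_orders.1, qc_layout_orders.2])
  rwa [qc_layout_orders.1, qc_layout_orders.2] at h

/-- `qc` has a toric layout. KERNEL. -/
theorem qc_hasToricLayout : HasToricLayout qc.css.tannerGraph :=
  ⟨5, 5, by norm_num, by norm_num, qc_hasToricLayoutWith⟩

end Summit.Ventures.QEC.Census.SD8lc_n50_k10_955a5347
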